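import Literature.AlgebraicGeometry.Morphisms.GlueDataRelative
import HarnessLib

/-!
# Relative gluing: functoriality and uniqueness up to isomorphism

[StacksProject, Tag 01LH] (relative glueing) asserts that the glued `f : X → S` comes WITH isomorphisms
`f⁻¹(Uᵢ) ≅ Xᵢ` over `Uᵢ` recovering the `θᵢⱼ` — whence `X` is unique up to unique isomorphism over `S`; more
generally glueing is FUNCTORIAL in the relative cocycle datum ([GortzWedhorn2020] Prop. 3.5, gluing of morphisms).

For two relative cocycle data `(Z, z, θ)` and `(Z', z', θ')` over the SAME base glue data `D : Scheme.GlueData`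
(★ `GlueDataRelative`: `relativeGlueData`, the glued morphisms `Φ`, `Φ'` to `D.glued`) and chart morphisms
`α i : Z i ⟶ Z' i` OVER `U i` (`hα : α i ≫ z' i = z i`) with overlap maps
`αV i j : Z i ×_{U i} V (i, j) ⟶ Z' i ×_{U i} V (i, j)` over them (`hαV₁`, `hαV₂`) and compatible with the
transition maps (`hαθ : αV i j ≫ θ' i j = θ i j ≫ αV j i`), THIS FILE records:

* `isPullback_relativeOverlapMap` — the overlap squares are CARTESIAN (because `α i` is over `U i`);
* `relativeGlueData_existsUnique_mapOfHom` — a UNIQUE `Ψ : glued ⟶ glued'` with `ι i ≫ Ψ = α i ≫ ι' i`;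
* `relativeGlueData_mapOfHom_comp_map` — `Ψ ≫ Φ' = Φ` (a morphism over `D.glued`);
* `relativeGlueData_isPullback_ι_mapOfHom` — the charts of `Ψ` are cartesian, `Z i = Ψ⁻¹(Z' i)`;
* `relativeGlueData_mapOfHom_of_isZariskiLocalAtTarget` — `Ψ` inherits every target-local property of the `α i`;
* `relativeGlueData_isIso_mapOfHom` — all `α i` isomorphisms ⇒ `Ψ` an isomorphism (uniqueness of relative
  glueing up to isomorphism).

All are instances of ★ `GlueDataOverBase` §2–§3 with `e := id`, `φ := α`, `φV := αV`.  Theorems only (no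
definition, no named fact, no `sorry`, no instance).  Cell hodgecm-mathlib, F-DAG price sheet §5b hand (h7)
«Zariski gluing of `S`-objects from a cocycle», FILE 2b; consumer leaf F-8 (8c)/(8e) (comparison of the glued
universal family with any other glueing; glued morphisms between glued families, e.g. a polarisation).  HC_CM is
proved only modulo the printed citations until rung 0 closes; this file discharges none of them.

## References
* [StacksProject] The Stacks Project, Tag 01LH (Relative glueing), Tag 01JA (Glueing schemes).
* [GortzWedhorn2020] U. Görtz, T. Wedhorn, *Algebraic Geometry I*, 2nd ed. (2020), Section (3.3) Prop. 3.5,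
  Section (3.5) Prop. 3.10, Section (4.8) Lemma 4.28, Section (4.9) Def. 4.29.
-/

noncomputable section

universe u

open CategoryTheory CategoryTheory.Limits AlgebraicGeometry TopologicalSpace

namespace Literature.AlgebraicGeometry.Morphisms

section RelativeMap

variable (D : Scheme.GlueData.{u})
  {Z : D.J → Scheme.{u}} {z : ∀ i, Z i ⟶ D.U i}
  {θ : ∀ i j, pullback (z i) (D.f i j) ⟶ pullback (z j) (D.f j i)}
  {hθ : ∀ i j, θ i j ≫ pullback.snd (z j) (D.f j i) = pullback.snd (z i) (D.f i j) ≫ D.t i j}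
  {hθid : ∀ i, θ i i = 𝟙 _}
  {hcoc : ∀ i j k, relativeT' D Z z θ hθ i j k ≫ relativeT' D Z z θ hθ j k i ≫ relativeT' D Z z θ hθ k i j = 𝟙 _}
  {Z' : D.J → Scheme.{u}} {z' : ∀ i, Z' i ⟶ D.U i}
  {θ' : ∀ i j, pullback (z' i) (D.f i j) ⟶ pullback (z' j) (D.f j i)}
  {hθ' : ∀ i j, θ' i j ≫ pullback.snd (z' j) (D.f j i) = pullback.snd (z' i) (D.f i j) ≫ D.t i j}
  {hθid' : ∀ i, θ' i i = 𝟙 _}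
  {hcoc' : ∀ i j k,
    relativeT' D Z' z' θ' hθ' i j k ≫ relativeT' D Z' z' θ' hθ' j k i ≫ relativeT' D Z' z' θ' hθ' k i j = 𝟙 _}

/-- **The overlap squares of a morphism of relative cocycle data are CARTESIAN**: for chart morphisms
`α i : Z i ⟶ Z' i` OVER `U i` (`hα`) and overlap maps `αV i j` over them (`hαV₁`) and over `V (i, j)` (`hαV₂`),
`Z i ×_{U i} V (i, j) = Z i ×_{Z' i} (Z' i ×_{U i} V (i, j))` (cancellation of pull-back squares,
[GortzWedhorn2020] Section (4.8)). [cite: StacksProject, Tag 01LH] [cite: GortzWedhorn2020, Section (4.8) Lemma 4.28] -/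
theorem isPullback_relativeOverlapMap (α : ∀ i, Z i ⟶ Z' i) (hα : ∀ i, α i ≫ z' i = z i)
    (αV : ∀ i j, pullback (z i) (D.f i j) ⟶ pullback (z' i) (D.f i j))
    (hαV₁ : ∀ i j, αV i j ≫ pullback.fst (z' i) (D.f i j) = pullback.fst (z i) (D.f i j) ≫ α i)
    (hαV₂ : ∀ i j, αV i j ≫ pullback.snd (z' i) (D.f i j) = pullback.snd (z i) (D.f i j)) (i j : D.J) :
    IsPullback (pullback.fst (z i) (D.f i j)) (αV i j) (α i) (pullback.fst (z' i) (D.f i j)) := by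
  have s : IsPullback (αV i j ≫ pullback.snd (z' i) (D.f i j)) (pullback.fst (z i) (D.f i j)) (D.f i j)
      (α i ≫ z' i) := by
    rw [hαV₂, hα]
    exact (IsPullback.of_hasPullback (z i) (D.f i j)).flip
  exact (s.of_right (hαV₁ i j) (IsPullback.of_hasPullback (z' i) (D.f i j)).flip).flip

/-- **Functoriality of relative glueing — existence and uniqueness** ([StacksProject, Tag 01LH]; [GortzWedhorn2020]
Prop. 3.5): chart morphisms `α i : Z i ⟶ Z' i` with overlap maps `αV i j` over them (`hαV₁`) compatible with the
transition maps (`hαθ`) glue to a UNIQUE `Ψ` between the glued schemes with `ι i ≫ Ψ = α i ≫ ι' i` — ★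
`glueData_existsUnique_map` with `e := id`, `φ := α`, `φV := αV`. [cite: StacksProject, Tag 01LH]
[cite: GortzWedhorn2020, Section (3.3) Proposition 3.5] -/
theorem relativeGlueData_existsUnique_mapOfHom (α : ∀ i, Z i ⟶ Z' i)
    (αV : ∀ i j, pullback (z i) (D.f i j) ⟶ pullback (z' i) (D.f i j))
    (hαV₁ : ∀ i j, αV i j ≫ pullback.fst (z' i) (D.f i j) = pullback.fst (z i) (D.f i j) ≫ α i)
    (hαθ : ∀ i j, αV i j ≫ θ' i j = θ i j ≫ αV j i) :
    ∃! Ψ : (relativeGlueData D Z z θ hθ hθid hcoc).glued ⟶ (relativeGlueData D Z' z' θ' hθ' hθid' hcoc').glued,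
      ∀ i, (relativeGlueData D Z z θ hθ hθid hcoc).ι i ≫ Ψ =
        α i ≫ (relativeGlueData D Z' z' θ' hθ' hθid' hcoc').ι i :=
  glueData_existsUnique_map (relativeGlueData D Z z θ hθ hθid hcoc) (relativeGlueData D Z' z' θ' hθ' hθid' hcoc')
    id α αV hαV₁ hαθ

/-- **The glued morphism of relative data is a morphism OVER the base**: with `Φ`, `Φ'` the glued morphisms to
`D.glued` (`relativeGlueData_existsUnique_map`) and the `α i` over `U i` (`hα`), `Ψ ≫ Φ' = Φ` — ★
`glueData_map_comp_desc`. [cite: StacksProject, Tag 01LH] [cite: GortzWedhorn2020, Section (3.3) Proposition 3.5] -/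
theorem relativeGlueData_mapOfHom_comp_map (α : ∀ i, Z i ⟶ Z' i) (hα : ∀ i, α i ≫ z' i = z i)
    (Ψ : (relativeGlueData D Z z θ hθ hθid hcoc).glued ⟶ (relativeGlueData D Z' z' θ' hθ' hθid' hcoc').glued)
    (hΨ : ∀ i, (relativeGlueData D Z z θ hθ hθid hcoc).ι i ≫ Ψ =
      α i ≫ (relativeGlueData D Z' z' θ' hθ' hθid' hcoc').ι i)
    (Φ : (relativeGlueData D Z z θ hθ hθid hcoc).glued ⟶ D.glued)
    (hΦ : ∀ i, (relativeGlueData D Z z θ hθ hθid hcoc).ι i ≫ Φ = z i ≫ D.ι i)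
    (Φ' : (relativeGlueData D Z' z' θ' hθ' hθid' hcoc').glued ⟶ D.glued)
    (hΦ' : ∀ i, (relativeGlueData D Z' z' θ' hθ' hθid' hcoc').ι i ≫ Φ' = z' i ≫ D.ι i) : Ψ ≫ Φ' = Φ :=
  glueData_map_comp_desc (D₁ := relativeGlueData D Z z θ hθ hθid hcoc)
    (D₂ := relativeGlueData D Z' z' θ' hθ' hθid' hcoc') (e := id) (φ := α)
    (fun i => z i ≫ D.ι i) Φ hΦ (fun i => z' i ≫ D.ι i) Φ' hΦ' Ψ hΨ
    (fun i => by
      show α i ≫ z' i ≫ D.ι i = z i ≫ D.ι i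
      rw [← Category.assoc, hα])

/-- **The charts of the glued morphism of relative data are CARTESIAN**: `Z i = Ψ⁻¹(Z' i)` — ★
`glueData_isPullback_ι_map` with the cartesian overlap squares `isPullback_relativeOverlapMap`.
[cite: StacksProject, Tag 01LH] [cite: GortzWedhorn2020, Section (4.8) Lemma 4.28] -/
theorem relativeGlueData_isPullback_ι_mapOfHom (α : ∀ i, Z i ⟶ Z' i) (hα : ∀ i, α i ≫ z' i = z i)
    (αV : ∀ i j, pullback (z i) (D.f i j) ⟶ pullback (z' i) (D.f i j))
    (hαV₁ : ∀ i j, αV i j ≫ pullback.fst (z' i) (D.f i j) = pullback.fst (z i) (D.f i j) ≫ α i)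
    (hαV₂ : ∀ i j, αV i j ≫ pullback.snd (z' i) (D.f i j) = pullback.snd (z i) (D.f i j))
    (Ψ : (relativeGlueData D Z z θ hθ hθid hcoc).glued ⟶ (relativeGlueData D Z' z' θ' hθ' hθid' hcoc').glued)
    (hΨ : ∀ i, (relativeGlueData D Z z θ hθ hθid hcoc).ι i ≫ Ψ =
      α i ≫ (relativeGlueData D Z' z' θ' hθ' hθid' hcoc').ι i) (i : D.J) :
    IsPullback ((relativeGlueData D Z z θ hθ hθid hcoc).ι i) (α i) Ψ
      ((relativeGlueData D Z' z' θ' hθ' hθid' hcoc').ι i) :=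
  glueData_isPullback_ι_map (D₁ := relativeGlueData D Z z θ hθ hθid hcoc)
    (D₂ := relativeGlueData D Z' z' θ' hθ' hθid' hcoc') (e := id) (φ := α) (φV := αV)
    (fun i j => isPullback_relativeOverlapMap D α hα αV hαV₁ hαV₂ i j) Ψ hΨ i

/-- **The glued morphism of relative data inherits every property local at the target from its charts `α i`**
(`IsIso`, `IsProper`, `IsClosedImmersion`, `Flat`, …) — ★ `glueData_map_of_isZariskiLocalAtTarget` (`e := id` onto,
cartesian overlap squares). [cite: GortzWedhorn2020, Section (4.9) Definition 4.29] [cite: StacksProject, Tag 01LH] -/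
theorem relativeGlueData_mapOfHom_of_isZariskiLocalAtTarget (α : ∀ i, Z i ⟶ Z' i) (hα : ∀ i, α i ≫ z' i = z i)
    (αV : ∀ i j, pullback (z i) (D.f i j) ⟶ pullback (z' i) (D.f i j))
    (hαV₁ : ∀ i j, αV i j ≫ pullback.fst (z' i) (D.f i j) = pullback.fst (z i) (D.f i j) ≫ α i)
    (hαV₂ : ∀ i j, αV i j ≫ pullback.snd (z' i) (D.f i j) = pullback.snd (z i) (D.f i j))
    (P : MorphismProperty Scheme.{u}) [IsZariskiLocalAtTarget P]
    (Ψ : (relativeGlueData D Z z θ hθ hθid hcoc).glued ⟶ (relativeGlueData D Z' z' θ' hθ' hθid' hcoc').glued)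
    (hΨ : ∀ i, (relativeGlueData D Z z θ hθ hθid hcoc).ι i ≫ Ψ =
      α i ≫ (relativeGlueData D Z' z' θ' hθ' hθid' hcoc').ι i) (h : ∀ i, P (α i)) : P Ψ :=
  glueData_map_of_isZariskiLocalAtTarget (D₁ := relativeGlueData D Z z θ hθ hθid hcoc)
    (D₂ := relativeGlueData D Z' z' θ' hθ' hθid' hcoc') (e := id) (φ := α) (φV := αV) P Function.surjective_id
    (fun i j => isPullback_relativeOverlapMap D α hα αV hαV₁ hαV₂ i j) Ψ hΨ h

/-- **Uniqueness of relative glueing up to isomorphism** ([StacksProject, Tag 01LH]: the glued `f : X → S` with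
`f⁻¹(Uᵢ) ≅ Xᵢ` recovering the `θᵢⱼ` is unique up to unique isomorphism): if every chart morphism `α i` is an
isomorphism, so is the glued `Ψ`. [cite: StacksProject, Tag 01LH] [cite: GortzWedhorn2020, Section (3.5) Proposition 3.10] -/
theorem relativeGlueData_isIso_mapOfHom (α : ∀ i, Z i ⟶ Z' i) (hα : ∀ i, α i ≫ z' i = z i)
    (αV : ∀ i j, pullback (z i) (D.f i j) ⟶ pullback (z' i) (D.f i j))
    (hαV₁ : ∀ i j, αV i j ≫ pullback.fst (z' i) (D.f i j) = pullback.fst (z i) (D.f i j) ≫ α i)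
    (hαV₂ : ∀ i j, αV i j ≫ pullback.snd (z' i) (D.f i j) = pullback.snd (z i) (D.f i j))
    (Ψ : (relativeGlueData D Z z θ hθ hθid hcoc).glued ⟶ (relativeGlueData D Z' z' θ' hθ' hθid' hcoc').glued)
    (hΨ : ∀ i, (relativeGlueData D Z z θ hθ hθid hcoc).ι i ≫ Ψ =
      α i ≫ (relativeGlueData D Z' z' θ' hθ' hθid' hcoc').ι i) (h : ∀ i, IsIso (α i)) : IsIso Ψ :=
  glueData_isIso_map (D₁ := relativeGlueData D Z z θ hθ hθid hcoc)
    (D₂ := relativeGlueData D Z' z' θ' hθ' hθid' hcoc') (e := id) (φ := α) (φV := αV) Function.surjective_id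
    (fun i j => isPullback_relativeOverlapMap D α hα αV hαV₁ hαV₂ i j) Ψ hΨ h

end RelativeMap

end Literature.AlgebraicGeometry.Morphisms

end
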